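import Summits.NavierStokesRegularity.NavierStokesRegularity.Theorems.IntenseSetDoorsAssemblyCalm
import HarnessLib

/-!
# S34 «IntenseSetDoors» — tools for plate A34-D (door D «CriticalTwistDoor»)

Summits-side proof file (theorems only): the fixed-time estimate behind door S34-D.
* `setIntegral_pow_three_le_of_lintegral_le`, `twist_density_basic` — bookkeeping of the twist density
  `X = ‖v × ω‖/‖v‖` (`0 ≤ X ≤ ‖ω‖`, `‖v × ω‖ ≤ ‖v‖·X`);
* `young_twist` — the Young step `k r P Q ≤ ν P² + (k²/4)T_s^{−1}Q²` for `r² = ν/T_s`;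
* `setIntegral_cross_sq_le_of_twist` — **Hölder `(3, 3/2)` on the intense set + Sobolev for the velocity**:
  `∫_{|ω|>L} (‖v × ω‖/‖v‖)³ ≤ m³ ⇒ ∫_{|ω|>L} ‖v × ω‖² ≤ (m K₆)² ∫‖∇v‖²`.
HONEST FRAME: tools for a regularity CRITERION; 0056 `NoTypeII` / NS regularity NOT proved.
-/

noncomputable section

set_option linter.dupNamespace false

open MeasureTheory Set Function Filter Metric Real InnerProductSpace
open _root_.Topology
open scoped ENNReal NNReal RealInnerProductSpace ContDiff
open Literature.Analysis Literature.Analysis.FluidPDE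
open Summit.NavierStokesRegularity.NavierStokesRegularity.Theorems.CriticalCoherenceDoor
  (SubcriticalEnstrophyContinuation exponent_of_lt_sqrt_three_div_four)

namespace Summit.NavierStokesRegularity.NavierStokesRegularity.Theorems.IntenseSetDoors

-- nested operator types (second derivatives)
set_option maxSynthPendingDepth 3

/-! ### §1 Small tools -/

/-- Door hypotheses to Bochner set integrals, cubic version for a measurable non-negative scalar:
`∫⁻_S ofReal (X³) ≤ ofReal r`, `0 ≤ r`, give `∫_S X³ ≤ r`. [folklore] -/
theorem setIntegral_pow_three_le_of_lintegral_le {S : Set (EuclideanSpace ℝ (Fin 3))}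
    {X : (EuclideanSpace ℝ (Fin 3)) → ℝ} (hX : Measurable X) (hX0 : ∀ x, 0 ≤ X x) {r : ℝ}
    (h : ∫⁻ x in S, ENNReal.ofReal (X x ^ 3) ≤ ENNReal.ofReal r) (hr : 0 ≤ r) :
    ∫ x in S, X x ^ 3 ≤ r := by
  rw [integral_eq_lintegral_of_nonneg_ae (Eventually.of_forall fun x => pow_nonneg (hX0 x) 3)
    (hX.pow_const 3).aestronglyMeasurable]
  calc (∫⁻ x in S, ENNReal.ofReal (X x ^ 3)).toReal ≤ (ENNReal.ofReal r).toReal :=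
        ENNReal.toReal_mono ENNReal.ofReal_ne_top h
    _ = r := ENNReal.toReal_ofReal hr

/-- The twist density `X = ‖v × ω‖/‖v‖` (`:= 0` where `v = 0`): `0 ≤ X`, `X ≤ ‖ω‖`, and
`‖v × ω‖ ≤ ‖v‖ X` pointwise. [folklore] -/
theorem twist_density_basic (a b : EuclideanSpace ℝ (Fin 3)) :
    0 ≤ ‖cross a b‖ / ‖a‖ ∧ ‖cross a b‖ / ‖a‖ ≤ ‖b‖ ∧ ‖cross a b‖ ≤ ‖a‖ * (‖cross a b‖ / ‖a‖) := by
  have hc := norm_cross_le_norm_mul_norm a b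
  refine ⟨div_nonneg (norm_nonneg _) (norm_nonneg _), ?_, ?_⟩
  · rcases eq_or_lt_of_le (norm_nonneg a) with h0 | hpos
    · rw [← h0, div_zero]; exact norm_nonneg _
    · rw [div_le_iff₀ hpos, mul_comm]; exact hc
  · rcases eq_or_lt_of_le (norm_nonneg a) with h0 | hpos
    · have : ‖cross a b‖ ≤ 0 := by simpa [← h0] using hc
      rw [← h0, zero_mul]; exact this
    · rw [mul_div_cancel₀ _ hpos.ne']

/-- Young's inequality in the form used by plate A34-D: with `r² = ν/T_s`,
`k r P Q ≤ ν P² + (k²/4) T_s^{-1} Q²` (`4ν(ν P² + k²r²Q²/(4ν) − k r P Q) = (2νP − k r Q)² ≥ 0`).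
[folklore] -/
theorem young_twist {ν Ts r k P Q : ℝ} (hν : 0 < ν) (hTs : 0 < Ts) (hr2 : r * r = ν / Ts) :
    k * r * P * Q ≤ ν * (P * P) + k ^ 2 / 4 / Ts * (Q * Q) := by
  have h1 : 4 * ν * (k * r * P * Q) ≤ 4 * ν * (ν * (P * P)) + k ^ 2 * (r * r) * (Q * Q) := by
    nlinarith [sq_nonneg (2 * ν * P - k * r * Q)]
  rw [hr2] at h1
  have h2 : k ^ 2 * (ν / Ts) * (Q * Q) = 4 * ν * (k ^ 2 / 4 / Ts * (Q * Q)) := by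
    field_simp
  rw [h2, ← mul_add] at h1
  exact le_of_mul_le_mul_left h1 (by positivity)

/-! ### §2 The Lamb energy on a twist-calm intense set -/

/-- **Hölder `(3, 3/2)` on the intense set + Sobolev for the velocity.** For a `C²` field `v` with
`v, ∇v ∈ L²`, `v`, `∇v`, `∇²v` bounded (`ω = curl v`), a level `L > 0` and `m ≥ 0` with
`∫_{|ω| > L} (‖v × ω‖/‖v‖)³ ≤ m³`: `∫_{|ω| > L} ‖v × ω‖² ≤ (m K₆)² ∫ ‖∇v‖²`, `K₆` the tree's
`H¹ ⊂ L⁶` constant (`‖v × ω‖ ≤ ‖v‖·(‖v × ω‖/‖v‖)`, Hölder on the intense set,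
`∫_S ‖v‖⁶ ≤ ∫ ‖v‖⁶ ≤ (K₆‖∇v‖₂)⁶`). [folklore] -/
theorem setIntegral_cross_sq_le_of_twist
    {v : (EuclideanSpace ℝ (Fin 3)) → (EuclideanSpace ℝ (Fin 3))} (hv : ContDiff ℝ 2 v)
    (hE : Integrable fun x => ‖v x‖ ^ 2) (hG : Integrable fun x => ‖fderiv ℝ v x‖ ^ 2) {B : ℝ}
    (hB : ∀ x, ‖fderiv ℝ (fderiv ℝ v) x‖ ≤ B) {B₁ : ℝ} (hB₁ : ∀ x, ‖fderiv ℝ v x‖ ≤ B₁)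
    {B₀ : ℝ} (hB₀ : ∀ x, ‖v x‖ ≤ B₀)
    {L : ℝ} (hL : 0 < L) {m : ℝ} (hm : 0 ≤ m)
    (h3 : ∫ x in {x | L < ‖curl v x‖}, (‖cross (v x) (curl v x)‖ / ‖v x‖) ^ 3 ≤ m ^ 3) :
    ∫ x in {x | L < ‖curl v x‖}, ‖cross (v x) (curl v x)‖ ^ 2 ≤
      (m * (SNormLESNormFDerivOfEqConst (EuclideanSpace ℝ (Fin 3))
          (volume : Measure (EuclideanSpace ℝ (Fin 3))) 2 : ℝ)) ^ 2 *
        ∫ x, ‖fderiv ℝ v x‖ ^ 2 := by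
  set K₆ : ℝ := (SNormLESNormFDerivOfEqConst (EuclideanSpace ℝ (Fin 3))
    (volume : Measure (EuclideanSpace ℝ (Fin 3))) 2 : ℝ) with hK₆
  have hK₆0 : 0 ≤ K₆ := NNReal.coe_nonneg _
  have hvc : Continuous v := hv.continuous
  have hv1 : ContDiff ℝ 1 v := hv.of_le (by norm_num)
  have hω1 : ContDiff ℝ 1 (curl v) := contDiff_curl (n := 1) (by exact hv)
  have hωc : Continuous (curl v) := hω1.continuous
  have hB₁0 : 0 ≤ B₁ := (norm_nonneg _).trans (hB₁ 0)
  have hB₀0 : 0 ≤ B₀ := (norm_nonneg _).trans (hB₀ 0)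
  have hωbd : ∀ x, ‖curl v x‖ ≤ ‖curlCLM‖ * B₁ := fun x =>
    (norm_curl_le v x).trans (mul_le_mul_of_nonneg_left (hB₁ x) (norm_nonneg _))
  -- the twist density
  set X : (EuclideanSpace ℝ (Fin 3)) → ℝ := fun x => ‖cross (v x) (curl v x)‖ / ‖v x‖ with hX
  have hXm : Measurable X :=
    (crossCLM.continuous₂.comp₂ hvc hωc).norm.measurable.div hvc.norm.measurable
  have hX0 : ∀ x, 0 ≤ X x := fun x => (twist_density_basic (v x) (curl v x)).1
  have hXle : ∀ x, X x ≤ ‖curl v x‖ := fun x => (twist_density_basic (v x) (curl v x)).2.1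
  have hcX : ∀ x, ‖cross (v x) (curl v x)‖ ≤ ‖v x‖ * X x := fun x =>
    (twist_density_basic (v x) (curl v x)).2.2
  -- `‖v‖⁶` is integrable (`v` bounded, `v ∈ L²`)
  have I6 : Integrable fun x => ‖v x‖ ^ 6 := by
    refine (hE.const_mul (B₀ ^ 4)).mono' ((hvc.norm.pow 6).aestronglyMeasurable)
      (Eventually.of_forall fun x => ?_)
    rw [Real.norm_of_nonneg (by positivity)]
    have h4 : ‖v x‖ ^ 4 ≤ B₀ ^ 4 := pow_le_pow_left₀ (norm_nonneg _) (hB₀ x) 4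
    calc ‖v x‖ ^ 6 = ‖v x‖ ^ 4 * ‖v x‖ ^ 2 := by ring
      _ ≤ B₀ ^ 4 * ‖v x‖ ^ 2 := mul_le_mul_of_nonneg_right h4 (sq_nonneg _)
  -- the intense set, a compact container, finite measure
  set S : Set (EuclideanSpace ℝ (Fin 3)) := {x | L < ‖curl v x‖} with hS
  have hSm : MeasurableSet S := (isOpen_lt continuous_const hωc.norm).measurableSet
  obtain ⟨t, ht, htS⟩ : ∃ t : Set (EuclideanSpace ℝ (Fin 3)), IsCompact t ∧ S ⊆ t :=
    exists_isCompact_superlevel_subset (tendsto_curl_cocompact hv hG hB) hL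
  have hSfin : volume S < ⊤ := (measure_mono htS).trans_lt ht.measure_lt_top
  haveI : IsFiniteMeasure (volume.restrict S) := isFiniteMeasure_restrict.2 hSfin.ne
  -- the two Hölder factors
  set f : (EuclideanSpace ℝ (Fin 3)) → ℝ := fun x => ‖v x‖ ^ 2 with hf
  set g : (EuclideanSpace ℝ (Fin 3)) → ℝ := fun x => X x ^ 2 with hg
  have hfc : Continuous f := hvc.norm.pow 2
  have hgm' : Measurable g := hXm.pow_const 2
  have hfm : MemLp f (ENNReal.ofReal 3) (volume.restrict S) := by
    refine (memLp_top_of_bound hfc.aestronglyMeasurable (B₀ ^ 2) ?_).mono_exponent le_top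
    refine Eventually.of_forall fun x => ?_
    rw [hf, Real.norm_of_nonneg (sq_nonneg _)]
    exact pow_le_pow_left₀ (norm_nonneg _) (hB₀ x) 2
  have hgm : MemLp g (ENNReal.ofReal (3 / 2)) (volume.restrict S) := by
    refine (memLp_top_of_bound hgm'.aestronglyMeasurable ((‖curlCLM‖ * B₁) ^ 2) ?_).mono_exponent
      le_top
    refine Eventually.of_forall fun x => ?_
    rw [hg, Real.norm_of_nonneg (sq_nonneg _)]
    exact pow_le_pow_left₀ (hX0 x) ((hXle x).trans (hωbd x)) 2
  have hHC : (3 : ℝ).HolderConjugate (3 / 2) :=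
    { inv_add_inv_eq_inv := by norm_num
      left_pos := by norm_num
      right_pos := by norm_num }
  have hHolder := integral_mul_le_Lp_mul_Lq_of_nonneg (μ := volume.restrict S) hHC
    (Eventually.of_forall fun x => sq_nonneg _) (Eventually.of_forall fun x => sq_nonneg _) hfm hgm
  -- the factors
  have hf3 : ∫ x in S, f x ^ (3 : ℝ) = ∫ x in S, ‖v x‖ ^ 6 :=
    integral_congr_ae (Eventually.of_forall fun x => sq_rpow_three (norm_nonneg _))
  have hg3 : ∫ x in S, g x ^ (3 / 2 : ℝ) = ∫ x in S, X x ^ 3 :=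
    integral_congr_ae (Eventually.of_forall fun x => Lemma142.sq_rpow_three_halves (hX0 x))
  set Gv : ℝ := ∫ x, ‖fderiv ℝ v x‖ ^ 2 with hGv
  have hGv0 : 0 ≤ Gv := integral_nonneg fun x => sq_nonneg _
  have hsob := FarhatGrujic2018.integral_norm_pow_six_le hv1 hE hG I6
  have h6S : ∫ x in S, ‖v x‖ ^ 6 ≤ (K₆ * Real.sqrt Gv) ^ 6 :=
    (setIntegral_le_integral I6 (Eventually.of_forall fun x => by positivity)).trans hsob
  have hA : (∫ x in S, f x ^ (3 : ℝ)) ^ (1 / (3 : ℝ)) ≤ (K₆ * Real.sqrt Gv) ^ 2 := by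
    rw [hf3, ← pow_six_rpow_third (by positivity : 0 ≤ K₆ * Real.sqrt Gv)]
    exact Real.rpow_le_rpow (setIntegral_nonneg hSm fun x _ => by positivity) h6S (by norm_num)
  have hBfac : (∫ x in S, g x ^ (3 / 2 : ℝ)) ^ (1 / (3 / 2 : ℝ)) ≤ m ^ 2 := by
    rw [hg3, show (1 : ℝ) / (3 / 2) = 2 / 3 by norm_num, ← rpow_three_twoThirds hm]
    exact Real.rpow_le_rpow (setIntegral_nonneg hSm fun x _ => pow_nonneg (hX0 x) 3) h3
      (by norm_num)
  have hsq : (K₆ * Real.sqrt Gv) ^ 2 = K₆ ^ 2 * Gv := by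
    rw [mul_pow, Real.sq_sqrt hGv0]
  -- the Lamb energy is dominated by `∫_S f g`
  have IX : IntegrableOn (fun x => ‖cross (v x) (curl v x)‖ ^ 2) S :=
    (((crossCLM.continuous₂.comp₂ hvc hωc).norm.pow 2).continuousOn.integrableOn_compact
      ht).mono_set htS
  have Ifg : IntegrableOn (fun x => f x * g x) S := by
    refine Measure.integrableOn_of_bounded (M := B₀ ^ 2 * (‖curlCLM‖ * B₁) ^ 2) hSfin.ne
      ((hfc.measurable.mul hgm').aestronglyMeasurable) (Eventually.of_forall fun x => ?_)
    rw [Real.norm_of_nonneg (mul_nonneg (sq_nonneg _) (sq_nonneg _))]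
    exact mul_le_mul (pow_le_pow_left₀ (norm_nonneg _) (hB₀ x) 2)
      (pow_le_pow_left₀ (hX0 x) ((hXle x).trans (hωbd x)) 2) (sq_nonneg _) (sq_nonneg _)
  have hΛfg : ∫ x in S, ‖cross (v x) (curl v x)‖ ^ 2 ≤ ∫ x in S, f x * g x := by
    refine integral_mono IX Ifg fun x => ?_
    simp only [hf, hg]
    rw [← mul_pow]
    exact pow_le_pow_left₀ (norm_nonneg _) (hcX x) 2
  calc ∫ x in S, ‖cross (v x) (curl v x)‖ ^ 2 ≤ ∫ x in S, f x * g x := hΛfg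
    _ ≤ (∫ x in S, f x ^ (3 : ℝ)) ^ (1 / (3 : ℝ)) *
          (∫ x in S, g x ^ (3 / 2 : ℝ)) ^ (1 / (3 / 2 : ℝ)) := hHolder
    _ ≤ (K₆ * Real.sqrt Gv) ^ 2 * m ^ 2 :=
        mul_le_mul hA hBfac (Real.rpow_nonneg (setIntegral_nonneg hSm fun x _ => by positivity) _)
          (sq_nonneg _)
    _ = (m * K₆) ^ 2 * Gv := by rw [hsq]; ring

end Summit.NavierStokesRegularity.NavierStokesRegularity.Theorems.IntenseSetDoors

end
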